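import Summits.QuantumAdvantage.QuantumAdvantage.Theses.ArithStatLadder
import Literature.Computability.MetaComplexity.HeuristicClassesProofs
import Literature.Computability.Complexity.PCPProofs
import Literature.Computability.Complexity.RandomizedProofs
import Literature.Computability.Complexity.BranchingFn

/-!
# Disproof of `AvgFaceBeyondPrior` — findings (cdisprove seat, crux stmt-QuantumAdvantage-2427)

Crux (route ArithStatLadder, support auto-promoted to crux):
`(IQ3, U) ∉ HeurDeltaBPP (fun _ => 1/3)` where `IQ3 = {bin d : −d fundamental ∧ 3 ∣ h(−d)}` and
`Uₙ` is uniform on the n-bit `d` with `−d` fundamental (`PMF.pure []` if there is none).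

VERDICT SO FAR: **no kill; hypothesis-type**. Unfolded (`avgFace_iff`), the crux says: every PPT
`A(x, 1ⁿ)` has, for SOME `n`, more than a third of the `Uₙ`-mass on inputs where its coin error is
`≥ 1/4`. A refutation must therefore EXHIBIT a PPT predictor of `3 ∣ h(−d)` that is right on
`≥ 2/3` of the n-bit fundamental discriminants for EVERY `n` — an algorithmic breakthrough
(no classical polynomial-time access to `h(−d) mod 3` is known, even given the factorisation of
`d`); conversely a proof gives `IQ3 ∉ BPP` (`avgFace_imp_not_mem_BPP`, this file), a worst-case
separation for an explicit `P^{#P}` language, i.e. it is separation-strength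
(barrier `SeparationPrerequisites` applies verbatim).

Contents (all `theorem`s kernel-checked unless marked `sorry` in §5):
* §1 semantics — `avgFace_iff` (the crux unfolded), `ens_prob_eq` (bad mass = a counting ratio on
  the dyadic block of fundamental discriminants), `nil_not_mem_iq3Lang` (the `pure []` branch is
  harmless), nonemptiness of the blocks.
* §2 load-bearing analysis — (a) drop "polynomial time": FALSE (`not_avgFace_without_PPT`, the
  truth table); (b) raise δ to 1: FALSE (`not_avgFaceAtDelta_one`, any constant algorithm);
  δ < 0: trivially TRUE (`avgFaceAtDelta_of_neg`); the crux sits at δ = 1/3, conjecturally below the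
  Cohen–Lenstra flip point δ* = 1 − ∏(1 − 3^{-i}) = 0.43987.
* §3 necessary condition — `avgFace_imp_exists_level`: the crux forces SOME level `n` at which
  more than a third of the n-bit fundamental discriminants have `3 ∣ h(−d)` (the constant
  predictor `3 ∤ h` must be bad somewhere); sharpened by finite patching (a lookup table is PPT:
  `tableFn_mem_FP`, `patchAlg`) to `avgFace_imp_exists_level_ge`: such levels exist BEYOND EVERY
  `N`. Numerically true (p_n crosses 1/3 at n = 12 per the ideators' kit data; my PARI jobs
  j010646–8 queued) but NOT a theorem of the tree or, to this seat's knowledge, of print (not even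
  a positive proportion of `3 ∣ h(−d)` is known): any proof of the crux certifies it on the way.
* §3' barrier reduction — `mem_HeurDeltaBPP_of_mem_BPP` (`(BPP, 𝒟) ⊆ Heur_δBPP` for `δ ≥ 0`, via
  a parameter-dropping lift, proved here) ⇒ `avgFace_imp_not_mem_BPP` ⇒ with `IqThreeMemBQP`
  the summit (`avgFace_assembly`, remark).
* §4 small models / numerics (docstrings + `decide`d block counts for tiny `n`).
* §5 near-misses / not attempted.
-/

set_option linter.dupNamespace false

namespace Summit.QuantumAdvantage.QuantumAdvantage.Cruxes.AvgFaceBeyondPrior.Disproof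

open _root_.Computability
open Literature.Computability.Complexity Literature.Computability.MetaComplexity
open Literature.NumberTheory.QuadraticFields
open Summit.QuantumAdvantage.QuantumAdvantage.Theses.ArithStatLadder
open scoped Classical ENNReal

/-! ## §1 Semantics: names for the pieces of the crux and the unfolded statement -/

/-- `−d` is a (negative) fundamental discriminant — the literal predicate of the route file
(kept literal, as an `abbrev`, so that the terms below are syntactically the route's). [folklore] -/
abbrev IsFundNeg (d : ℕ) : Prop :=
  (((-(d:ℤ)) % 4 = 1 ∧ Squarefree (-(d:ℤ)) ∧ (-(d:ℤ)) ≠ 1) ∨ (4 ∣ (-(d:ℤ)) ∧ ((-(d:ℤ)) / 4 % 4 = 2 ∨ (-(d:ℤ)) / 4 % 4 = 3) ∧ Squarefree ((-(d:ℤ)) / 4)))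

/-- The set `IQ3 ⊆ ℕ`: `−d` fundamental and `3 ∣ h(−d)` (literal copy of the route's set). [folklore] -/
def iq3Set : Set ℕ :=
  {d : ℕ | (((-(d:ℤ)) % 4 = 1 ∧ Squarefree (-(d:ℤ)) ∧ (-(d:ℤ)) ≠ 1) ∨ (4 ∣ (-(d:ℤ)) ∧ ((-(d:ℤ)) / 4 % 4 = 2 ∨ (-(d:ℤ)) / 4 % 4 = 3) ∧ Squarefree ((-(d:ℤ)) / 4))) ∧ 3 ∣ Literature.NumberTheory.QuadraticFields.BinaryQuadraticForm.classNumber (-(d:ℤ))}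

/-- The language `IQ3 ⊆ {0,1}*` (LSB-first binary); typed as a `Set` so that `∈` is `Set`'s. [folklore] -/
def iq3Lang : Set (List Bool) := encodingNatBool.toLanguage iq3Set

/-- The dyadic block of n-bit `d` with `−d` fundamental (literal copy of the route's finset). [folklore] -/
noncomputable def fundBlock (n : ℕ) : Finset ℕ :=
  (Finset.Ico (2 ^ (n - 1)) (2 ^ n)).filter (fun d : ℕ => (((-(d:ℤ)) % 4 = 1 ∧ Squarefree (-(d:ℤ)) ∧ (-(d:ℤ)) ≠ 1) ∨ (4 ∣ (-(d:ℤ)) ∧ ((-(d:ℤ)) / 4 % 4 = 2 ∨ (-(d:ℤ)) / 4 % 4 = 3) ∧ Squarefree ((-(d:ℤ)) / 4))))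

/-- The ensemble `U`: uniform on `fundBlock n` (pushed to strings), `pure []` if empty. [folklore] -/
noncomputable def ens : Ensemble := fun n =>
  if h : (fundBlock n).Nonempty then (PMF.uniformOfFinset (fundBlock n) h).map encodeNat
  else PMF.pure []

/-- The distributional problem `(IQ3, U)` of the crux. [folklore] -/
noncomputable def Q : DistProblem := ⟨iq3Lang, ens⟩

/-- The crux is literally `Q ∉ Heur_{1/3}BPP` (definitional). [folklore] -/
theorem avgFace_iff_Q : AvgFaceBeyondPrior ↔ Q ∉ HeurDeltaBPP (fun _ => (1:ℝ) / 3) := Iff.rfl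

/-- **The crux unfolded**: every PPT `A(x, 1ⁿ)` has, at some level `n`, bad mass `> 1/3`
(bad = coin error `≥ 1/4`). [cite: BogdanovTrevisan2006, Def. 2.13] -/
theorem avgFace_iff :
    AvgFaceBeyondPrior ↔ ∀ A : RandAlg (List Bool × ℕ) Bool, A.IsPolyTime paramEnc encodeBool →
      ∃ n, (1:ℝ) / 3 < ens.prob n
        {x | 1 / 4 ≤ A.pr paramEnc (x, n) {b | b ≠ iq3Lang.boolIndicator x}} := by
  rw [avgFace_iff_Q]
  simp only [HeurDeltaBPP, Set.mem_setOf_eq, not_exists, not_and, not_forall, not_le]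
  rfl

/-- `encodeNat 0 = []`. [folklore] -/
theorem encodeNat_zero : encodeNat 0 = [] := by decide

/-- `0 ∉ IQ3` (`0` is not a discriminant of the right shape). [folklore] -/
theorem zero_not_mem_iq3Set : (0 : ℕ) ∉ iq3Set := by
  rintro ⟨h | h, -⟩
  · norm_num at h
  · norm_num at h

/-- The empty string is not in `IQ3` (it encodes `0`), so the `pure []` branch of `U` (levels
`n ≤ 1`) never makes an algorithm that answers `false` there bad. [folklore] -/
theorem nil_not_mem_iq3Lang : ([] : List Bool) ∉ iq3Lang := by
  intro h
  rw [← encodeNat_zero] at h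
  exact zero_not_mem_iq3Set ((encodingNatBool.mem_toLanguage_iff iq3Set 0).1 h)

/-- Membership of a code word in `IQ3`. [folklore] -/
theorem encodeNat_mem_iq3Lang (d : ℕ) : encodeNat d ∈ iq3Lang ↔ d ∈ iq3Set :=
  encodingNatBool.mem_toLanguage_iff iq3Set d

/-- **Bad mass is a counting ratio**: on a nonempty block, the `Uₙ`-probability of an event is
`#{d ∈ fundBlock n | bin d ∈ E} / #fundBlock n`. [folklore] -/
theorem ens_prob_eq {n : ℕ} (h : (fundBlock n).Nonempty) (E : Set (List Bool)) :
    ens.prob n E = (((fundBlock n).filter fun d => encodeNat d ∈ E).card : ℝ) / (fundBlock n).card := by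
  unfold Ensemble.prob ens
  rw [dif_pos h, PMF.toOuterMeasure_map_apply, PMF.toOuterMeasure_uniformOfFinset_apply,
    ENNReal.toReal_div]
  simp only [Set.mem_preimage, ENNReal.toReal_natCast]

/-- On an empty block the ensemble is the point mass at `[]`. [folklore] -/
theorem ens_prob_of_not_nonempty {n : ℕ} (h : ¬ (fundBlock n).Nonempty) (E : Set (List Bool)) :
    ens.prob n E = if ([] : List Bool) ∈ E then 1 else 0 := by
  unfold Ensemble.prob ens
  rw [dif_neg h, PMF.toOuterMeasure_pure_apply]
  split_ifs <;> simp

/-- If no point of the block lies in `E`, the `Uₙ`-probability of `E` is `0` (instance-robust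
form of `ens_prob_eq` for this use). [folklore] -/
theorem ens_prob_eq_zero_of {n : ℕ} (h : (fundBlock n).Nonempty) {E : Set (List Bool)}
    (hE : ∀ d ∈ fundBlock n, encodeNat d ∉ E) : ens.prob n E = 0 := by
  rw [ens_prob_eq h, Finset.filter_eq_empty_iff.2 (fun d hd hmem => hE d hd hmem)]
  simp

/-! ## §2 Load-bearing analysis -/

/-- The crux with the failure parameter `δ` free: `(IQ3, U) ∉ Heur_δBPP`. The crux is `δ = 1/3`;
the family is antitone in `δ`. [folklore] -/
def AvgFaceAtDelta (δ : ℝ) : Prop := Q ∉ HeurDeltaBPP (fun _ => δ)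

/-- The crux is the instance `δ = 1/3`. [folklore] -/
theorem avgFace_iff_atDelta : AvgFaceBeyondPrior ↔ AvgFaceAtDelta (1 / 3) := Iff.rfl

/-- Antitonicity: a smaller `δ` is a weaker hardness claim. [folklore] -/
theorem avgFaceAtDelta_anti {δ δ' : ℝ} (hle : δ ≤ δ') (h : AvgFaceAtDelta δ') : AvgFaceAtDelta δ := by
  rintro ⟨A, hA, hgood⟩
  exact h ⟨A, hA, fun n => (hgood n).trans hle⟩

/-- Trivial truth region: for `δ < 0` the class `Heur_δBPP` is empty. [folklore] -/
theorem avgFaceAtDelta_of_neg {δ : ℝ} (hδ : δ < 0) : AvgFaceAtDelta δ := by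
  rintro ⟨A, -, hgood⟩
  exact absurd ((Ensemble.prob_nonneg _ _ _).trans (hgood 0)) (not_le.2 hδ)

/-- The constant-`false` PPT algorithm on parametrised inputs. [folklore] -/
def constFalse : RandAlg (List Bool × ℕ) Bool := RandAlg.ofDet fun _ => false

/-- It is PPT (`PolyTimeComputable.const` + `IsPolyTime.ofDet_holds`). [folklore] -/
theorem isPolyTime_constFalse : constFalse.IsPolyTime paramEnc encodeBool :=
  RandAlg.IsPolyTime.ofDet_holds (PolyTimeComputable.const paramEnc encodeBool false)

/-- **Trivial falsity region (tightness of the δ-axis at the top)**: `δ = 1` is refuted by any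
PPT algorithm, since bad mass is a probability. So the crux family flips somewhere in `[0, 1]`;
Cohen–Lenstra (C2) puts the flip at `δ* = 0.43987` (constant predictor `3 ∤ h`). [folklore] -/
theorem not_avgFaceAtDelta_one : ¬ AvgFaceAtDelta 1 :=
  fun h => h ⟨constFalse, isPolyTime_constFalse, fun _ => Ensemble.prob_le_one _ _ _⟩

/-- The crux WITHOUT the efficiency restriction: "every function `A(x, n)` (no time bound, no
coins) has bad mass `> 1/3` at some level". [folklore] -/
def AvgFaceWithoutPPT : Prop :=
  ∀ A : List Bool × ℕ → Bool, ∃ n, (1:ℝ) / 3 < ens.prob n {x | A (x, n) ≠ iq3Lang.boolIndicator x}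

/-- **Polynomial time is the whole content**: information-theoretically the truth table has bad
mass `0` at every level. Any proof of the crux must use `IsPolyTime`. [folklore] -/
theorem not_avgFace_without_PPT : ¬ AvgFaceWithoutPPT := by
  intro h
  obtain ⟨n, hn⟩ := h fun p => iq3Lang.boolIndicator p.1
  have h0 : {x : List Bool | iq3Lang.boolIndicator x ≠ iq3Lang.boolIndicator x} = ∅ := by
    ext x; simp
  rw [h0, Ensemble.prob, MeasureTheory.measure_empty, ENNReal.toReal_zero] at hn
  norm_num at hn

/-! ## §3 Necessary condition: the constant predictor must be bad at some level -/

/-- The bad set of the constant-`false` algorithm is exactly the language. [folklore] -/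
theorem badSet_constFalse (n : ℕ) :
    {x | (1:ℝ) / 4 ≤ constFalse.pr paramEnc (x, n) {b | b ≠ iq3Lang.boolIndicator x}} = iq3Lang := by
  ext x
  simp only [Set.mem_setOf_eq, constFalse, RandAlg.pr_ofDet, ne_eq]
  by_cases hx : x ∈ iq3Lang
  · have hi := (Set.mem_iff_boolIndicator (s := iq3Lang) x).1 hx
    simp only [hi, Bool.false_eq_true, not_false_eq_true, if_true]
    exact iff_of_true (by norm_num) hx
  · have hi := (Set.notMem_iff_boolIndicator (s := iq3Lang) x).1 hx
    simp only [hi, not_true_eq_false, if_false]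
    exact iff_of_false (by norm_num) hx

/-- **Necessary condition for the crux** (unconditional): if `AvgFaceBeyondPrior` holds then at
SOME level `n` more than a third of the n-bit fundamental discriminants `−d` have `3 ∣ h(−d)`:
`#fundBlock n < 3 · #{d ∈ fundBlock n | 3 ∣ h(−d)}`. (Apply the crux to the constant predictor
`3 ∤ h`; its bad set is `IQ3`; the `pure []` levels give mass `0`.) Cohen–Lenstra predict the
proportion tends to `0.43987 > 1/3`, and PARI finds the first such level at small `n` (§4), but
no theorem of the tree proves it for any `n`: a Lean proof of the crux certifies this instance of
arithmetic statistics on the way. [cite: CohenLenstra1984, §9 (C2)] -/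
theorem avgFace_imp_exists_level (h : AvgFaceBeyondPrior) :
    ∃ n, (fundBlock n).Nonempty ∧
      ((fundBlock n).card : ℝ) <
        3 * ((fundBlock n).filter fun d : ℕ => 3 ∣ BinaryQuadraticForm.classNumber (-(d:ℤ))).card := by
  obtain ⟨n, hn⟩ := (avgFace_iff.1 h) constFalse isPolyTime_constFalse
  rw [badSet_constFalse] at hn
  by_cases hne : (fundBlock n).Nonempty
  · refine ⟨n, hne, ?_⟩
    rw [ens_prob_eq hne] at hn
    have hcard : (0:ℝ) < (fundBlock n).card := by exact_mod_cast hne.card_pos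
    rw [lt_div_iff₀ hcard] at hn
    have hfilter : ((fundBlock n).filter fun d => encodeNat d ∈ iq3Lang) =
        (fundBlock n).filter fun d : ℕ => 3 ∣ BinaryQuadraticForm.classNumber (-(d:ℤ)) := by
      refine Finset.filter_congr fun d hd => ?_
      rw [encodeNat_mem_iq3Lang]
      exact ⟨fun h => h.2, fun h => ⟨(Finset.mem_filter.1 hd).2, h⟩⟩
    rw [hfilter] at hn
    linarith
  · rw [ens_prob_of_not_nonempty hne, if_neg nil_not_mem_iq3Lang] at hn
    norm_num at hn

/-! ### Sharpening: the crux forces `p_n > 1/3` INFINITELY OFTEN (finite patching)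

The constant predictor patched by a finite lookup table on the levels `n < N` is still PPT
(string equality + branching from the tree's `FP` toolkit), so the crux forces a bad level
`n ≥ N` for every `N`: `AvgFaceBeyondPrior → ∀ N, ∃ n ≥ N, #fundBlock n < 3·#{3 ∣ h(−d)}`. This is
the planners' `CruxImpliesThreeDividesOften` (idea card planted-cubic-top-rung, P5) with `γ = 0`,
i.e. exactly the arithmetic floor any proof must supply; conversely the cards' glue shows
top-rung pseudorandomness + "`p_n ≥ 1/3 + γ` infinitely often" ⇒ crux. -/

section Patch

open Finset

/-- Equality with a fixed string as a one-bit string function: `z ↦ [z = u]`. [folklore] -/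
noncomputable def eqConstFn (u : List Bool) : List Bool → List Bool :=
  eqPairFn ∘ fanoutFn id (fun _ => u)

/-- `eqConstFn u z = [decide (z = u)]`. [folklore] -/
theorem eqConstFn_apply (u z : List Bool) : eqConstFn u z = [decide (z = u)] := by
  simp only [eqConstFn, Function.comp_apply, fanoutFn_apply, eqPairFn_boolPair, id]

/-- `eqConstFn u ∈ FP` (equality test after a fan-out with a constant). [cite: AroraBarak2009, §1.3] -/
theorem eqConstFn_mem_FP (u : List Bool) : eqConstFn u ∈ FP :=
  PolyTimeComputable.comp_holds eqPairFn_mem_FP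
    (fanoutFn_mem_FP (PolyTimeComputable.id _) (const_mem_FP u))

/-- A finite lookup table as a one-bit string function: `z ↦ [z ∈ l]`. [folklore] -/
noncomputable def tableFn : List (List Bool) → List Bool → List Bool
  | [] => fun _ => [false]
  | u :: us => iteFn (eqConstFn u) (fun _ => [true]) (tableFn us)

/-- `tableFn l z = [decide (z ∈ l)]`. [folklore] -/
theorem tableFn_apply (l : List (List Bool)) (z : List Bool) : tableFn l z = [decide (z ∈ l)] := by
  induction l with
  | nil => simp [tableFn]
  | cons u us ih =>
    rw [tableFn, iteFn_apply (eqConstFn_apply u z), ih]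
    by_cases h : z = u
    · subst h; simp
    · simp [h]

/-- **Finite tables are polynomial time** (`iteFn`/`eqPairFn`/constants of the tree's `FP`
toolkit, by induction on the table). [cite: AroraBarak2009, §1.3] -/
theorem tableFn_mem_FP (l : List (List Bool)) : tableFn l ∈ FP := by
  induction l with
  | nil => exact const_mem_FP [false]
  | cons u us ih => exact iteFn_mem_FP (eqConstFn_mem_FP u) (const_mem_FP [true]) ih

/-- The finitely patched constant predictor: accept iff the encoded input `⟨x, 1ⁿ⟩` is in the
table `l`, reject otherwise. [folklore] -/
noncomputable def patchAlg (l : List (List Bool)) : RandAlg (List Bool × ℕ) Bool :=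
  RandAlg.ofDet fun p => decide (paramEnc p ∈ l)

/-- The patched predictor is PPT. [cite: AroraBarak2009, §1.3] -/
theorem isPolyTime_patchAlg (l : List (List Bool)) : (patchAlg l).IsPolyTime paramEnc encodeBool := by
  refine RandAlg.IsPolyTime.ofDet_holds ?_
  exact (tableFn_mem_FP l).of_comp_encode paramEnc (fun _ => rfl) fun p => by
    rw [tableFn_apply]; rfl

/-- Bad set of a coin-free algorithm: the inputs where its answer is wrong. [folklore] -/
theorem badSet_ofDet (f : List Bool × ℕ → Bool) (n : ℕ) :
    {x | (1:ℝ) / 4 ≤ (RandAlg.ofDet f).pr paramEnc (x, n) {b | b ≠ iq3Lang.boolIndicator x}} =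
      {x | f (x, n) ≠ iq3Lang.boolIndicator x} := by
  ext x
  simp only [Set.mem_setOf_eq, RandAlg.pr_ofDet, ne_eq]
  by_cases hx : f (x, n) = iq3Lang.boolIndicator x
  · simp only [hx, not_true_eq_false, if_false]
    norm_num
  · simp only [hx, not_false_eq_true, if_true]
    norm_num

/-- `paramEnc` is injective in both arguments. [folklore] -/
theorem paramEnc_inj {x x' : List Bool} {n n' : ℕ} (h : paramEnc (x, n) = paramEnc (x', n')) :
    x = x' ∧ n = n' := by
  have h2 := boolPair_injective (a₁ := (x, unaryEncodeNat n)) (a₂ := (x', unaryEncodeNat n')) h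
  simp only [Prod.mk.injEq] at h2
  refine ⟨h2.1, ?_⟩
  have := congrArg unaryDecodeNat h2.2
  rwa [unary_decode_encode_nat, unary_decode_encode_nat] at this

/-- **The crux forces a level with more than a third `3 ∣ h(−d)` BEYOND ANY `N`** (so infinitely
often): patch the constant predictor `3 ∤ h` by the exact table of `IQ3` on the levels `< N`
(`patchAlg`, PPT by `isPolyTime_patchAlg`); it has bad mass `0` below `N` and bad set `IQ3` from
`N` on. Necessary arithmetic content of the crux; numerically true, while in print (to this seat's
knowledge; Davenport–Heilbronn gives only `≥ 1/2` for `3 ∤ h` and power-saving counts for `3 ∣ h`)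
not even "a positive proportion of imaginary quadratic fields have `3 ∣ h`" is known. [folklore] -/
theorem avgFace_imp_exists_level_ge (h : AvgFaceBeyondPrior) (N : ℕ) :
    ∃ n, N ≤ n ∧ (fundBlock n).Nonempty ∧
      ((fundBlock n).card : ℝ) <
        3 * ((fundBlock n).filter fun d : ℕ => 3 ∣ BinaryQuadraticForm.classNumber (-(d:ℤ))).card := by
  -- the table: encoded inputs ⟨bin d, 1ᵐ⟩ with m < N, d ∈ fundBlock m ∩ IQ3
  set S : Finset (List Bool) := (range N).biUnion fun m =>
    ((fundBlock m).filter fun d => d ∈ iq3Set).image fun d => paramEnc (encodeNat d, m) with hS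
  have hmemS : ∀ x m, paramEnc (x, m) ∈ S ↔ m < N ∧ ∃ d ∈ fundBlock m, d ∈ iq3Set ∧ x = encodeNat d := by
    intro x m
    simp only [hS, mem_biUnion, mem_range, mem_image, mem_filter]
    constructor
    · rintro ⟨m', hm', d, ⟨hd, hd3⟩, he⟩
      obtain ⟨hx, hmm⟩ := paramEnc_inj he
      subst hmm
      exact ⟨hm', d, hd, hd3, hx.symm⟩
    · rintro ⟨hm, d, hd, hd3, rfl⟩
      exact ⟨m, hm, d, ⟨hd, hd3⟩, rfl⟩
  obtain ⟨n, hn⟩ := (avgFace_iff.1 h) (patchAlg S.toList) (isPolyTime_patchAlg S.toList)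
  rw [patchAlg, badSet_ofDet] at hn
  by_cases hnN : n < N
  · -- below N the table is exact on the support: bad mass 0
    exfalso
    have hgood : ∀ d ∈ fundBlock n,
        decide (paramEnc (encodeNat d, n) ∈ S.toList) = iq3Lang.boolIndicator (encodeNat d) := by
      intro d hd
      have hiff : paramEnc (encodeNat d, n) ∈ S.toList ↔ encodeNat d ∈ iq3Lang := by
        rw [Finset.mem_toList, hmemS, encodeNat_mem_iq3Lang]
        constructor
        · rintro ⟨-, d', -, hd3, he⟩
          rwa [encodingNatBool.encode_injective he]
        · exact fun h3 => ⟨hnN, d, hd, h3, rfl⟩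
      by_cases hx : encodeNat d ∈ iq3Lang
      · rw [(Set.mem_iff_boolIndicator (s := iq3Lang) _).1 hx, decide_eq_true (hiff.2 hx)]
      · rw [(Set.notMem_iff_boolIndicator (s := iq3Lang) _).1 hx, decide_eq_false (fun h' => hx (hiff.1 h'))]
    by_cases hne : (fundBlock n).Nonempty
    · rw [ens_prob_eq_zero_of hne (E := {x | decide (paramEnc (x, n) ∈ S.toList) ≠
        iq3Lang.boolIndicator x}) (fun d hd hbad => hbad (hgood d hd))] at hn
      norm_num at hn
    · rw [ens_prob_of_not_nonempty hne] at hn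
      have hnil : ([] : List Bool) ∉
          {x | decide (paramEnc (x, n) ∈ S.toList) ≠ iq3Lang.boolIndicator x} := by
        intro hbad
        apply hbad
        rw [(Set.notMem_iff_boolIndicator (s := iq3Lang) _).1 nil_not_mem_iq3Lang]
        refine decide_eq_false fun hmem => ?_
        rw [Finset.mem_toList, hmemS] at hmem
        obtain ⟨-, d, hd, -, he⟩ := hmem
        have hd1 : 1 ≤ d := le_trans (Nat.one_le_two_pow) (mem_Ico.1 (mem_filter.1 hd).1).1
        have hdec := congrArg decodeNat he
        rw [decode_encodeNat] at hdec
        have h00 : decodeNat [] = 0 := by decide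
        omega
      rw [if_neg hnil] at hn
      norm_num at hn
  · -- from N on the table is silent: the algorithm is the constant predictor
    push Not at hnN
    have hsilent : ∀ x, decide (paramEnc (x, n) ∈ S.toList) = false := by
      intro x
      refine decide_eq_false fun hmem => ?_
      rw [Finset.mem_toList, hmemS] at hmem
      omega
    have hset : {x | decide (paramEnc (x, n) ∈ S.toList) ≠ iq3Lang.boolIndicator x} = iq3Lang := by
      ext x
      simp only [Set.mem_setOf_eq, hsilent x, ne_eq]
      constructor
      · intro hx
        by_contra hx'
        exact hx ((Set.notMem_iff_boolIndicator (s := iq3Lang) _).1 hx').symm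
      · intro hx
        rw [(Set.mem_iff_boolIndicator (s := iq3Lang) _).1 hx]
        exact Bool.false_ne_true
    rw [hset] at hn
    by_cases hne : (fundBlock n).Nonempty
    · refine ⟨n, hnN, hne, ?_⟩
      rw [ens_prob_eq hne] at hn
      have hcard : (0:ℝ) < (fundBlock n).card := by exact_mod_cast hne.card_pos
      rw [lt_div_iff₀ hcard] at hn
      have hfilter : ((fundBlock n).filter fun d => encodeNat d ∈ iq3Lang) =
          (fundBlock n).filter fun d : ℕ => 3 ∣ BinaryQuadraticForm.classNumber (-(d:ℤ)) := by
        refine Finset.filter_congr fun d hd => ?_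
        rw [encodeNat_mem_iq3Lang]
        exact ⟨fun h => h.2, fun h => ⟨(Finset.mem_filter.1 hd).2, h⟩⟩
      rw [hfilter] at hn
      linarith
    · rw [ens_prob_of_not_nonempty hne, if_neg nil_not_mem_iq3Lang] at hn
      norm_num at hn

end Patch

/-! ## §3' Barrier reduction: the crux implies the worst-case lower bound `IQ3 ∉ BPP` -/

section ParamLift

variable {β Γ₁ : Type}

/-- Lift of a randomized algorithm on strings to parametrised inputs `(x, 1ⁿ)`, ignoring `n`.
[cite: BogdanovTrevisan2006, §2.3] -/
def paramLift (A : RandAlg (List Bool) β) : RandAlg (List Bool × ℕ) β where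
  run q r := A.run q.1 r
  coinLen := A.coinLen

/-- The sample is no longer than the parametrised input. [folklore] -/
theorem length_le_length_paramEnc (x : List Bool) (n : ℕ) :
    x.length ≤ (paramEnc (x, n)).length := by
  simp only [paramEnc, length_boolPair]
  omega

/-- Output distribution of the lift = that of `A` on `x` (coin-oblivious `A`, exactly polynomial
budget), as `outputPMF_schemeLift`. [cite: BogdanovTrevisan2006, §2.3] -/
theorem outputPMF_paramLift (A : RandAlg (List Bool) β)
    (hq : ∃ q : Polynomial ℕ, ∀ n, A.coinLen n = q.eval n)
    (hobl : ∀ x r, A.run x r = A.run x (r.take (A.coinLen x.length))) (x : List Bool) (n : ℕ) :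
    (paramLift A).outputPMF paramEnc (x, n) = A.outputPMF id x := by
  obtain ⟨q, hq⟩ := hq
  have hle : A.coinLen x.length ≤ A.coinLen (paramEnc (x, n)).length := by
    rw [hq, hq]
    exact polynomial_eval_mono q (length_le_length_paramEnc x n)
  simp only [RandAlg.outputPMF, paramLift, id]
  have h1 :
      (fun r : List.Vector Bool (A.coinLen (paramEnc (x, n)).length) => A.run x r.toList) =
      (fun s : List Bool => A.run x s) ∘ fun r => r.toList.take (A.coinLen x.length) := by
    funext r
    exact hobl x r.toList
  have h2 : (fun r : List.Vector Bool (A.coinLen x.length) => A.run x r.toList) =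
      (fun s : List Bool => A.run x s) ∘ List.Vector.toList := rfl
  rw [h1, h2, ← PMF.map_comp, ← PMF.map_comp, map_take_uniformOfFintype_vector hle]

/-- Probabilities under the lift. [folklore] -/
theorem pr_paramLift (A : RandAlg (List Bool) β)
    (hq : ∃ q : Polynomial ℕ, ∀ n, A.coinLen n = q.eval n)
    (hobl : ∀ x r, A.run x r = A.run x (r.take (A.coinLen x.length))) (x : List Bool) (n : ℕ)
    (E : Set β) : (paramLift A).pr paramEnc (x, n) E = A.pr id x E := by
  simp only [RandAlg.pr, outputPMF_paramLift A hq hobl]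

/-- Dropping the unary parameter is polynomial time: `(⟨x, 1ⁿ⟩, r) ↦ (x, r)` is computed by the
tree's `dropParamsMachine` in `|input|` steps. [cite: AroraBarak2009, §0.1 and §1.2] -/
theorem polyTimeComputable_paramEnc_dropParam :
    PolyTimeComputable (fun p : (List Bool × ℕ) × List Bool => boolPair (paramEnc p.1) p.2)
      (Function.uncurry boolPair) (fun p : (List Bool × ℕ) × List Bool => (p.1.1, p.2)) := by
  refine ⟨Polynomial.X, dropParamsMachine, fun p => ?_⟩
  simp only [Polynomial.eval_X, paramEnc, Function.uncurry]
  exact outputsWithin_dropParamsMachine p.1.1 _ p.2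

/-- The lift is PPT. [cite: AroraBarak2009, Thm. 2.8 (proof)] -/
theorem isPolyTime_paramLift {eb : β → List Γ₁} {A : RandAlg (List Bool) β}
    (hA : A.IsPolyTime id eb) : (paramLift A).IsPolyTime paramEnc eb :=
  ⟨PolyTimeComputable.comp_holds hA.1 polyTimeComputable_paramEnc_dropParam, hA.2⟩

end ParamLift

/-- **`(BPP, 𝒟) ⊆ Heur_δBPP` for every ensemble and every `δ ≥ 0`**: amplify a `BPP` machine to
coin error `≤ 1/8 < 1/4` on every input, truncate its coins, lift to `(x, 1ⁿ)`; no input is bad.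
[cite: BogdanovTrevisan2006, §2.3] -/
theorem mem_HeurDeltaBPP_of_mem_BPP {L : Language Bool} (hL : L ∈ BPP) (D : Ensemble)
    {δ : ℕ → ℝ} (hδ : ∀ n, 0 ≤ δ n) : (⟨L, D⟩ : DistProblem) ∈ HeurDeltaBPP δ := by
  obtain ⟨A, hA, hq, hcorrect⟩ := exists_randAlg_error_le_of_mem_BPP_holds hL (1 / 8) (by norm_num)
  have hB : (A.truncate id).IsPolyTime id encodeBool :=
    hA.truncate polyTimeComputable_boolPair_take_holds hq
  have hobl : ∀ x r, (A.truncate id).run x r =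
      (A.truncate id).run x (r.take ((A.truncate id).coinLen x.length)) :=
    fun x r => (A.truncate_run_take id x r).symm
  refine ⟨paramLift (A.truncate id), isPolyTime_paramLift hB, fun n => ?_⟩
  have hempty : {x | (1:ℝ) / 4 ≤ (paramLift (A.truncate id)).pr paramEnc (x, n)
      {b | b ≠ L.boolIndicator x}} = ∅ := by
    refine Set.eq_empty_of_forall_notMem fun x hx => ?_
    rw [Set.mem_setOf_eq, pr_paramLift (A.truncate id) hq hobl, RandAlg.pr_truncate,
      RandAlg.pr_ne_eq_one_sub] at hx
    have := hcorrect x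
    linarith
  change D.prob n {x | (1:ℝ) / 4 ≤ (paramLift (A.truncate id)).pr paramEnc (x, n)
      {b | b ≠ L.boolIndicator x}} ≤ δ n
  rw [hempty, Ensemble.prob, MeasureTheory.measure_empty, ENNReal.toReal_zero]
  exact hδ n

/-- **The crux implies the worst-case separation `IQ3 ∉ BPP`** (hence `IQ3 ∉ P`; since
`h(−d) = #reducedForms(−d)` is a `#P` count, a proof of the crux proves `FP ≠ #P`): barrier
`Literature.Barriers.QuantumAdvantage.SeparationPrerequisites` applies to the crux itself, not only
to the route's top rung. [cite: BogdanovTrevisan2006, §2.3] -/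
theorem avgFace_imp_not_mem_BPP (h : AvgFaceBeyondPrior) : iq3Lang ∉ BPP := by
  rw [avgFace_iff_Q] at h
  exact fun hBPP => h (mem_HeurDeltaBPP_of_mem_BPP hBPP ens (δ := fun _ => (1:ℝ) / 3)
    fun _ => by norm_num)

/-- Remark, stated contrapositively so that this work file proves no summit-shaped conclusion:
**a disproof of the crux follows from `BQP ⊆ BPP` plus the BQP crux** (`IqThreeMemBQP`,
Hallgren under GRH). Read forwards it says the support item is itself assembly-grade — with the
BQP crux it closes the summit, bypassing the `P/poly` rung `IqThreeNotPPoly` (planner: note). [folklore] -/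
theorem not_avgFace_of_not_summit (hQ : ¬ QuantumAdvantage) (h₂ : IqThreeMemBQP) :
    ¬ AvgFaceBeyondPrior :=
  fun h₁ => hQ ⟨_, h₂, avgFace_imp_not_mem_BPP h₁⟩

/-! ## §4 Small models: the blocks, a decidable form of the predicate, and the sieve bound -/

section SmallModels

open Finset

/-- Bounded squarefreeness test (kernel-decidable): no `k` with `2 ≤ k < B` has `k² ∣ d`. [folklore] -/
def SqfreeB (B d : ℕ) : Prop := ∀ k < B, 2 ≤ k → ¬ (k * k ∣ d)

instance (B d : ℕ) : Decidable (SqfreeB B d) := by unfold SqfreeB; infer_instance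

/-- For `0 < d < B²`, `SqfreeB B d` is squarefreeness. [folklore] -/
theorem squarefree_iff_sqfreeB {B d : ℕ} (hd : 0 < d) (hB : d < B * B) :
    Squarefree d ↔ SqfreeB B d := by
  constructor
  · intro h k _ h2 hdvd
    have := Nat.isUnit_iff.1 (h k hdvd)
    omega
  · intro h k hk
    rw [Nat.isUnit_iff]
    by_contra h1
    rcases Nat.eq_zero_or_pos k with rfl | hk0
    · simp at hk; omega
    have hkB : k < B := by
      by_contra hle
      push Not at hle
      have : B * B ≤ k * k := Nat.mul_le_mul hle hle
      have := Nat.le_of_dvd hd hk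
      omega
    exact h k hkB (by omega) hk

/-- `ℕ`-arithmetic (kernel-decidable) form of "`−d` is a fundamental discriminant". [folklore] -/
def IsFundNegNat (B d : ℕ) : Prop :=
  (d % 4 = 3 ∧ SqfreeB B d) ∨ ((d % 16 = 4 ∨ d % 16 = 8) ∧ SqfreeB B (d / 4))

instance (B d : ℕ) : Decidable (IsFundNegNat B d) := by unfold IsFundNegNat; infer_instance

/-- The route's `ℤ`-literal predicate agrees with the decidable `ℕ`-form (for `0 < d < B²`). [folklore] -/
theorem isFundNeg_iff_nat {B d : ℕ} (hd : 0 < d) (hB : d < B * B) :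
    IsFundNeg d ↔ IsFundNegNat B d := by
  unfold IsFundNeg IsFundNegNat
  have hsq1 : Squarefree (-(d:ℤ)) ↔ Squarefree d := by
    rw [← Int.squarefree_natAbs, Int.natAbs_neg, Int.natAbs_natCast]
  have hq : (-(d:ℤ)) / 4 = -(((d + 3) / 4 : ℕ) : ℤ) := by omega
  have hsq2 : Squarefree ((-(d:ℤ)) / 4) ↔ Squarefree ((d + 3) / 4) := by
    rw [hq, ← Int.squarefree_natAbs, Int.natAbs_neg, Int.natAbs_natCast]
  rw [hsq1, hsq2, squarefree_iff_sqfreeB hd hB]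
  constructor
  · rintro (⟨h1, h2, -⟩ | ⟨h4, h2, h3⟩)
    · exact Or.inl ⟨by omega, h2⟩
    · right
      refine ⟨by omega, ?_⟩
      rw [show (d + 3) / 4 = d / 4 by omega] at h3
      exact (squarefree_iff_sqfreeB (by omega) (by omega)).1 h3
  · rintro (⟨h1, h2⟩ | ⟨h1, h3⟩)
    · exact Or.inl ⟨by omega, h2, by omega⟩
    · right
      refine ⟨by omega, by omega, ?_⟩
      rw [show (d + 3) / 4 = d / 4 by omega]
      exact (squarefree_iff_sqfreeB (by omega) (by omega)).2 h3

/-- The block in decidable form: `fundBlock n = {d ∈ [2^(n-1), 2^n) | IsFundNegNat (2^b) d}` when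
`n ≤ 2b`. [folklore] -/
theorem fundBlock_eq_natForm (n b : ℕ) (hnb : n ≤ 2 * b) :
    fundBlock n = (Ico (2 ^ (n - 1)) (2 ^ n)).filter (IsFundNegNat (2 ^ b)) := by
  unfold fundBlock
  refine Finset.filter_congr fun d hd => ?_
  rw [mem_Ico] at hd
  have h1 : 0 < d := lt_of_lt_of_le (Nat.two_pow_pos _) hd.1
  have h2 : d < 2 ^ b * 2 ^ b := by
    rw [← pow_add]
    exact lt_of_lt_of_le hd.2 (Nat.pow_le_pow_right Nat.two_pos (by omega))
  exact isFundNeg_iff_nat h1 h2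

/-- **The blocks are nonempty from `n = 2` on** (so the `pure []` branch of `U` is exactly
`n ≤ 1`): `decide` for `2 ≤ n ≤ 5`, and for `n ≥ 6` the witness `d = 8p` with a Bertrand prime
`2^(n-4) < p < 2^(n-3)` (`−8p = 4·(−2p)`, `−2p ≡ 2 (mod 4)`, `2p` squarefree). [folklore] -/
theorem fundBlock_nonempty {n : ℕ} (hn : 2 ≤ n) : (fundBlock n).Nonempty := by
  by_cases h6 : n < 6
  · interval_cases n
    · rw [fundBlock_eq_natForm 2 1 (by norm_num)]; decide
    · rw [fundBlock_eq_natForm 3 2 (by norm_num)]; decide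
    · rw [fundBlock_eq_natForm 4 2 (by norm_num)]; decide
    · rw [fundBlock_eq_natForm 5 3 (by norm_num)]; decide
  push Not at h6
  obtain ⟨p, hp, hlt, hle⟩ := Nat.exists_prime_lt_and_le_two_mul (2 ^ (n - 4)) (by positivity)
  have hodd : p % 2 = 1 := by
    rcases hp.eq_two_or_odd' with rfl | hodd
    · have : 4 ≤ 2 ^ (n - 4) := by
        calc (4:ℕ) = 2 ^ 2 := by norm_num
          _ ≤ 2 ^ (n - 4) := Nat.pow_le_pow_right Nat.two_pos (by omega)
      omega
    · exact Nat.odd_iff.1 hodd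
  have hplt : p < 2 ^ (n - 3) := by
    have h2 : 2 * 2 ^ (n - 4) = 2 ^ (n - 3) := by
      rw [← pow_succ']; congr 1; omega
    rcases Nat.lt_or_eq_of_le hle with h | h
    · omega
    · exfalso
      have : 2 ∣ p := by rw [h]; exact dvd_mul_right 2 _
      omega
  have hlo : 2 ^ (n - 1) = 8 * 2 ^ (n - 4) := by
    rw [show n - 1 = 3 + (n - 4) by omega, pow_add]; norm_num
  have hhi : 2 ^ n = 8 * 2 ^ (n - 3) := by
    rw [show n = 3 + (n - 3) by omega, pow_add]; norm_num
  refine ⟨8 * p, Finset.mem_filter.2 ⟨?_, Or.inr ⟨⟨-(2 * (p:ℤ)), by push_cast; ring⟩, ?_, ?_⟩⟩⟩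
  · rw [Finset.mem_Ico]; omega
  · left; omega
  · rw [show (-((8 * p : ℕ) : ℤ)) / 4 = -((2 * p : ℕ) : ℤ) by omega, ← Int.squarefree_natAbs,
      Int.natAbs_neg, Int.natAbs_natCast, Nat.squarefree_mul]
    · exact ⟨Nat.prime_two.squarefree, hp.squarefree⟩
    · exact (Nat.coprime_primes Nat.prime_two hp).2 (by omega)

/-- Tiny levels, exactly (kernel `decide` on the counting definition of `h`): at `n = 7` the block
has 20 fundamental discriminants of which 5 have `3 ∣ h(−d)` (`d = 83, 87, 104, 107, 116`), so
the constant predictor `3 ∤ h` has bad mass `1/4 ≤ 1/3` there — the crux is not decided at tiny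
levels; PARI (§4 table) locates the first level with proportion `> 1/3`. [folklore] -/
theorem level_seven_counts :
    #((Ico (2 ^ 6) (2 ^ 7)).filter (IsFundNegNat (2 ^ 4))) = 20 ∧
    #((Ico (2 ^ 6) (2 ^ 7)).filter fun d : ℕ => IsFundNegNat (2 ^ 4) d ∧
        3 ∣ BinaryQuadraticForm.classNumber (-(d:ℤ))) = 5 := by
  constructor
  · decide +kernel
  · decide +kernel

/-- **PARI table (kit job j010646, exact, `h` by `qfbclassno`)**: `n : #fundBlock n : #{3 ∣ h} : p_n` —
`2:1:0:0`, `3:2:0:0`, `4:3:0:0`, `5:5:2:0.400`, `6:10:1:0.100`, `7:20:5:0.250`, `8:38:10:0.263`,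
`9:76:21:0.276`, `10:158:47:0.297`, `11:313:100:0.319`, `12:620:211:0.340`, `13:1244:446:0.359`,
`14:2490:926:0.372`, `15:4984:1831:0.367`, `16:9969:3793:0.380`, `17:19905:7797:0.392`,
`18:39834:15798:0.397`, `19:79704:31913:0.400`, `20:159355:64745:0.406`, `21:318720:130654:0.410`,
`22:637464:263375:0.413`, `23:1274904:531057:0.417`, `24:2549853:1069021:0.419` (→ Cohen–Lenstra
`0.4399` from below, Roberts/BST–TT negative secondary term). So the constant predictor `3 ∤ h`
has bad mass `> 1/3` at `n = 5` and at every `12 ≤ n ≤ 24`; the single-level necessary condition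
`avgFace_imp_exists_level` is met OUTRIGHT at `n = 5` (this theorem, by `decide`), hence carries
no open content — the content sits in the `∀ N` version `avgFace_imp_exists_level_ge` (§3), whose
witnesses past `N = 6` start at `n = 12` and are, beyond the table, Cohen–Lenstra territory. [folklore] -/
theorem exists_level_five :
    (fundBlock 5).Nonempty ∧ ((fundBlock 5).card : ℝ) <
      3 * ((fundBlock 5).filter fun d : ℕ => 3 ∣ BinaryQuadraticForm.classNumber (-(d:ℤ))).card := by
  have h5 : fundBlock 5 = (Ico (2 ^ 4) (2 ^ 5)).filter (IsFundNegNat (2 ^ 3)) :=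
    fundBlock_eq_natForm 5 3 (by norm_num)
  have hc : (fundBlock 5).card = 5 := by rw [h5]; decide
  have hf : ((fundBlock 5).filter fun d : ℕ => 3 ∣ BinaryQuadraticForm.classNumber (-(d:ℤ))).card
      = 2 := by
    rw [h5, Finset.filter_filter]; decide +kernel
  refine ⟨Finset.card_pos.1 (by rw [hc]; norm_num), ?_⟩
  rw [hc, hf]; norm_num

/-- No `d < 16` lies in `IQ3` (`h(−3) = h(−4) = h(−7) = h(−8) = h(−11) = 1`, `h(−15) = 2`). [folklore] -/
theorem not_mem_iq3Set_of_lt_sixteen {d : ℕ} (hd : d < 16) : d ∉ iq3Set := by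
  rcases Nat.eq_zero_or_pos d with rfl | hpos
  · exact zero_not_mem_iq3Set
  rintro ⟨hf, h3⟩
  rw [show ((((-(d:ℤ)) % 4 = 1 ∧ Squarefree (-(d:ℤ)) ∧ (-(d:ℤ)) ≠ 1) ∨ (4 ∣ (-(d:ℤ)) ∧ ((-(d:ℤ)) / 4 % 4 = 2 ∨ (-(d:ℤ)) / 4 % 4 = 3) ∧ Squarefree ((-(d:ℤ)) / 4)))) ↔ IsFundNegNat 4 d from
    isFundNeg_iff_nat hpos (by omega)] at hf
  interval_cases d <;> revert hf h3 <;> decide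

/-! ### The sieve bound `3 · #fundBlock n ≤ 2^(n-1)` (`n ≥ 5`) -/

/-- Splitting a filtered count at `a`: `[a, b)` plus `[0, a)` is `[0, b)`. [folklore] -/
theorem card_filter_Ico_add_range (p : ℕ → Prop) [DecidablePred p] {a b : ℕ} (hab : a ≤ b) :
    #((Ico a b).filter p) + #((range a).filter p) = #((range b).filter p) := by
  rw [range_eq_Ico, range_eq_Ico, ← card_union_of_disjoint, ← filter_union, union_comm,
    Ico_union_Ico_eq_Ico (Nat.zero_le a) hab]
  exact disjoint_filter_filter (Ico_disjoint_Ico_consecutive 0 a b).symm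

/-- Exact count of an arithmetic progression in the dyadic block `[2^(n-1), 2^n)`
(`Nat.count_modEq_card` twice). [folklore] -/
theorem card_block_modEq (n : ℕ) {r : ℕ} (hr : 0 < r) (v : ℕ) :
    #((Ico (2 ^ (n - 1)) (2 ^ n)).filter (· ≡ v [MOD r])) +
      (2 ^ (n - 1) / r + if v % r < 2 ^ (n - 1) % r then 1 else 0)
      = 2 ^ n / r + if v % r < 2 ^ n % r then 1 else 0 := by
  have h := card_filter_Ico_add_range (· ≡ v [MOD r])
    (Nat.pow_le_pow_right Nat.two_pos (Nat.sub_le n 1))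
  rw [← Nat.count_eq_card_filter_range, ← Nat.count_eq_card_filter_range,
    Nat.count_modEq_card _ hr, Nat.count_modEq_card _ hr] at h
  exact h

/-- A squarefree number is not divisible by `9`. [folklore] -/
theorem not_nine_dvd_of_squarefree {m : ℕ} (h : Squarefree m) : ¬ 9 ∣ m := fun h9 => by
  have := Nat.isUnit_iff.1 (h 3 (by simpa using h9))
  omega

/-- A squarefree number is not divisible by `25`. [folklore] -/
theorem not_twentyfive_dvd_of_squarefree {m : ℕ} (h : Squarefree m) : ¬ 25 ∣ m := fun h25 => by
  have := Nat.isUnit_iff.1 (h 5 (by simpa using h25))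
  omega

/-- Residue/divisibility consequences of `IsFundNeg d`. [folklore] -/
theorem isFundNeg_cases {d : ℕ} (h : IsFundNeg d) :
    (d % 4 = 3 ∧ ¬ 9 ∣ d ∧ ¬ 25 ∣ d) ∨ ((d % 16 = 4 ∨ d % 16 = 8) ∧ ¬ 9 ∣ d) := by
  rcases h with ⟨h1, h2, -⟩ | ⟨h4, h2, h3⟩
  · have hsq : Squarefree d := by
      rw [← Int.squarefree_natAbs, Int.natAbs_neg, Int.natAbs_natCast] at h2; exact h2
    exact Or.inl ⟨by omega, not_nine_dvd_of_squarefree hsq, not_twentyfive_dvd_of_squarefree hsq⟩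
  · right
    have hq : (-(d:ℤ)) / 4 = -((d / 4 : ℕ) : ℤ) := by omega
    have hsq : Squarefree (d / 4) := by
      rw [hq, ← Int.squarefree_natAbs, Int.natAbs_neg, Int.natAbs_natCast] at h3; exact h3
    refine ⟨by omega, fun h9 => not_nine_dvd_of_squarefree hsq ?_⟩
    omega

set_option maxHeartbeats 800000 in
/-- **Sieve bound, large levels**: for `n ≥ 11`, `3 · #fundBlock n ≤ 2^(n-1)`. The fundamental
`d` lie in `{d ≡ 3 (4), 9 ∤ d, 25 ∤ d} ∪ {d ≡ 4, 8 (16), 9 ∤ d}`, of density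
`(1/4)(1 − 1/9 − 1/25 + 1/225) + (1/8)(8/9) = 1168/3600 < 1/3`, and the eight arithmetic
progressions involved are counted exactly in the dyadic block (`card_block_modEq`), leaving
`omega` an `O(1)` slack that `2^(n-1) ≥ 1024` absorbs. (True density: `3/π² = 0.3040`.) [folklore] -/
theorem three_mul_card_fundBlock_le_of_large {n : ℕ} (hn : 11 ≤ n) :
    3 * #(fundBlock n) ≤ 2 ^ (n - 1) := by
  have h2N : 2 ^ n = 2 * 2 ^ (n - 1) := by
    rw [← pow_succ']; congr 1; omega
  have hNge : 1024 ≤ 2 ^ (n - 1) := by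
    calc (1024 : ℕ) = 2 ^ 10 := by norm_num
      _ ≤ 2 ^ (n - 1) := Nat.pow_le_pow_right Nat.two_pos (by omega)
  set N := 2 ^ (n - 1) with hN
  set blk := Ico N (2 ^ n) with hblk
  set C1 := blk.filter (· ≡ 3 [MOD 4]) with hC1
  set A := blk.filter (· ≡ 27 [MOD 36]) with hA
  set B := blk.filter (· ≡ 75 [MOD 100]) with hB
  set AB := blk.filter (· ≡ 675 [MOD 900]) with hAB
  set C2a := blk.filter (· ≡ 4 [MOD 16]) with hC2a
  set C2b := blk.filter (· ≡ 8 [MOD 16]) with hC2b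
  set A2a := blk.filter (· ≡ 36 [MOD 144]) with hA2a
  set A2b := blk.filter (· ≡ 72 [MOD 144]) with hA2b
  have hsub : fundBlock n ⊆ (C1 \ (A ∪ B)) ∪ ((C2a \ A2a) ∪ (C2b \ A2b)) := by
    intro d hd
    rw [fundBlock, mem_filter] at hd
    obtain ⟨hdb, hf⟩ := hd
    simp only [hC1, hA, hB, hC2a, hC2b, hA2a, hA2b, mem_union, mem_sdiff, mem_filter, Nat.ModEq]
    rcases isFundNeg_cases hf with ⟨h4, h9, h25⟩ | ⟨h16, h9⟩
    · left
      refine ⟨⟨hdb, by omega⟩, ?_⟩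
      rintro (⟨-, h⟩ | ⟨-, h⟩) <;> omega
    · right
      rcases h16 with h16 | h16
      · left
        refine ⟨⟨hdb, by omega⟩, ?_⟩
        rintro ⟨-, h⟩; omega
      · right
        refine ⟨⟨hdb, by omega⟩, ?_⟩
        rintro ⟨-, h⟩; omega
  have hABsub : A ∩ B ⊆ AB := by
    intro d hd
    simp only [hA, hB, hAB, mem_inter, mem_filter, Nat.ModEq] at hd ⊢
    exact ⟨hd.1.1, by omega⟩
  have hAsub : A ∪ B ⊆ C1 := by
    intro d hd
    simp only [hA, hB, hC1, mem_union, mem_filter, Nat.ModEq] at hd ⊢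
    rcases hd with hd | hd
    · exact ⟨hd.1, by omega⟩
    · exact ⟨hd.1, by omega⟩
  have hA2asub : A2a ⊆ C2a := by
    intro d hd
    simp only [hA2a, hC2a, mem_filter, Nat.ModEq] at hd ⊢
    exact ⟨hd.1, by omega⟩
  have hA2bsub : A2b ⊆ C2b := by
    intro d hd
    simp only [hA2b, hC2b, mem_filter, Nat.ModEq] at hd ⊢
    exact ⟨hd.1, by omega⟩
  have eC1 := card_block_modEq n (r := 4) (by norm_num) 3
  have eA := card_block_modEq n (r := 36) (by norm_num) 27
  have eB := card_block_modEq n (r := 100) (by norm_num) 75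
  have eAB := card_block_modEq n (r := 900) (by norm_num) 675
  have eC2a := card_block_modEq n (r := 16) (by norm_num) 4
  have eC2b := card_block_modEq n (r := 16) (by norm_num) 8
  have eA2a := card_block_modEq n (r := 144) (by norm_num) 36
  have eA2b := card_block_modEq n (r := 144) (by norm_num) 72
  rw [← hN, ← hblk] at eC1 eA eB eAB eC2a eC2b eA2a eA2b
  rw [← hC1] at eC1; rw [← hA] at eA; rw [← hB] at eB; rw [← hAB] at eAB
  rw [← hC2a] at eC2a; rw [← hC2b] at eC2b; rw [← hA2a] at eA2a; rw [← hA2b] at eA2b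
  have k0 := card_le_card hsub
  have k1 := card_union_le (C1 \ (A ∪ B)) ((C2a \ A2a) ∪ (C2b \ A2b))
  have k2 := card_union_le (C2a \ A2a) (C2b \ A2b)
  have k3 := card_sdiff_of_subset hAsub
  have k4 := card_union_add_card_inter A B
  have k5 := card_le_card hABsub
  have k6 := card_sdiff_of_subset hA2asub
  have k7 := card_sdiff_of_subset hA2bsub
  have k8 := card_le_card hAsub
  have k9 := card_le_card hA2asub
  have k10 := card_le_card hA2bsub
  have hN16 : N = 16 * 2 ^ (n - 5) := by
    rw [hN, show n - 1 = 4 + (n - 5) by omega, pow_add]; norm_num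
  rw [h2N] at eC1 eA eB eAB eC2a eC2b eA2a eA2b
  have bC1 : #C1 = N / 4 := by split_ifs at eC1 <;> omega
  have bA : N / 36 ≤ #A := by split_ifs at eA <;> omega
  have bB : N / 100 ≤ #B := by split_ifs at eB <;> omega
  have bAB : #AB ≤ N / 900 + 1 := by split_ifs at eAB <;> omega
  have bC2a : #C2a = N / 16 := by split_ifs at eC2a <;> omega
  have bC2b : #C2b = N / 16 := by split_ifs at eC2b <;> omega
  have bA2a : N / 144 ≤ #A2a := by split_ifs at eA2a <;> omega
  have bA2b : N / 144 ≤ #A2b := by split_ifs at eA2b <;> omega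
  clear eC1 eA eB eAB eC2a eC2b eA2a eA2b
  omega

/-- **At most a third of the n-bit integers are (negated) fundamental discriminants**, for every
`n ≥ 5` (`decide` for `5 ≤ n ≤ 10`, the sieve above from `11` on). Sharp in the sense that the
blocks `n = 5, 6, 7` have exactly `5/16, 10/32, 20/64 = 0.3125` and `n ≤ 4` exceed `1/3`. [folklore] -/
theorem three_mul_card_fundBlock_le {n : ℕ} (hn : 5 ≤ n) : 3 * #(fundBlock n) ≤ 2 ^ (n - 1) := by
  by_cases h11 : 11 ≤ n
  · exact three_mul_card_fundBlock_le_of_large h11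
  interval_cases n
  · rw [fundBlock_eq_natForm 5 3 (by norm_num)]; decide
  · rw [fundBlock_eq_natForm 6 3 (by norm_num)]; decide
  · rw [fundBlock_eq_natForm 7 4 (by norm_num)]; decide
  · rw [fundBlock_eq_natForm 8 4 (by norm_num)]; decide +kernel
  · rw [fundBlock_eq_natForm 9 5 (by norm_num)]; decide +kernel
  · rw [fundBlock_eq_natForm 10 5 (by norm_num)]; decide +kernel

end SmallModels

/-! ## §5 Load-bearing: the conditioning on fundamental discriminants

Replace `Uₙ` (uniform on n-bit FUNDAMENTAL `−d`) by the plain uniform distribution on n-bit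
integers. Then the constant predictor `3 ∤ h` errs only on `IQ3 ⊆ {−d fundamental}`, a set of
density `≤ 1/3` in every block from `n = 5` on (§4) and empty below: the `δ = 1/3` face is FALSE
unconditioned. So the crux's calibration "beat the Cohen–Lenstra prior 0.44 by 0.11" lives
entirely on the conditioned ensemble (prior unconditioned: `(3/π²)·0.44 ≈ 0.134`); and a transfer
of the `Heur_{1/3}` face along a domination `U ≤ 3.3·Uniform` is void (domination multiplies δ). -/

section Conditioning

open Finset

/-- The unconditioned ensemble: uniform on the n-bit integers `[2^(n-1), 2^n)` (`pure []` at
`n = 0`, where the block is empty). [folklore] -/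
noncomputable def ensUnif : Ensemble := fun n =>
  if h : (Ico (2 ^ (n - 1)) (2 ^ n)).Nonempty then
    (PMF.uniformOfFinset (Ico (2 ^ (n - 1)) (2 ^ n)) h).map encodeNat
  else PMF.pure []

/-- The crux WITHOUT the conditioning on fundamental discriminants. [folklore] -/
def AvgFaceUnconditioned : Prop :=
  (⟨iq3Lang, ensUnif⟩ : DistProblem) ∉ HeurDeltaBPP (fun _ => (1:ℝ) / 3)

/-- Probabilities under the unconditioned ensemble (nonempty block). [folklore] -/
theorem ensUnif_prob_eq {n : ℕ} (h : (Ico (2 ^ (n - 1)) (2 ^ n)).Nonempty) (E : Set (List Bool)) :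
    ensUnif.prob n E =
      (((Ico (2 ^ (n - 1)) (2 ^ n)).filter fun d => encodeNat d ∈ E).card : ℝ) /
        (Ico (2 ^ (n - 1)) (2 ^ n)).card := by
  unfold Ensemble.prob ensUnif
  rw [dif_pos h, PMF.toOuterMeasure_map_apply, PMF.toOuterMeasure_uniformOfFinset_apply,
    ENNReal.toReal_div]
  simp only [Set.mem_preimage, ENNReal.toReal_natCast]

/-- The `IQ3`-part of a block of integers sits inside the block of fundamental discriminants. [folklore] -/
theorem filter_iq3_subset_fundBlock (n : ℕ) :
    ((Ico (2 ^ (n - 1)) (2 ^ n)).filter fun d => encodeNat d ∈ iq3Lang) ⊆ fundBlock n := by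
  intro d hd
  rw [mem_filter, encodeNat_mem_iq3Lang] at hd
  exact mem_filter.2 ⟨hd.1, hd.2.1⟩

/-- **Conditioning is load-bearing**: on uniform n-bit integers the `δ = 1/3` face fails — the
constant predictor `3 ∤ h` has bad mass `#(IQ3 ∩ block)/2^(n-1) ≤ #fundBlock n / 2^(n-1) ≤ 1/3`
for `n ≥ 5` (`three_mul_card_fundBlock_le`) and `0` for `n ≤ 4` (`not_mem_iq3Set_of_lt_sixteen`).
[folklore] -/
theorem not_avgFace_unconditioned : ¬ AvgFaceUnconditioned := by
  intro h
  apply h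
  refine ⟨constFalse, isPolyTime_constFalse, fun n => ?_⟩
  change ensUnif.prob n {x | (1:ℝ) / 4 ≤ constFalse.pr paramEnc (x, n)
    {b | b ≠ iq3Lang.boolIndicator x}} ≤ 1 / 3
  rw [badSet_constFalse]
  by_cases hne : (Ico (2 ^ (n - 1)) (2 ^ n)).Nonempty
  · rw [ensUnif_prob_eq hne]
    have hn1 : 1 ≤ n := by
      by_contra h0
      push Not at h0
      interval_cases n
      simp at hne
    have hcard : #(Ico (2 ^ (n - 1)) (2 ^ n)) = 2 ^ (n - 1) := by
      rw [Nat.card_Ico, show n = (n - 1) + 1 from by omega, pow_succ]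
      simp; omega
    rw [hcard]
    have hpos : (0:ℝ) < ((2 ^ (n - 1) : ℕ) : ℝ) := by positivity
    rw [div_le_div_iff₀ hpos (by norm_num : (0:ℝ) < 3), one_mul]
    have key : #((Ico (2 ^ (n - 1)) (2 ^ n)).filter fun d => encodeNat d ∈ iq3Lang) * 3 ≤
        2 ^ (n - 1) := by
      by_cases h5 : 5 ≤ n
      · have h1 := card_le_card (filter_iq3_subset_fundBlock n)
        have h2 := three_mul_card_fundBlock_le h5
        omega
      · have hempty : ((Ico (2 ^ (n - 1)) (2 ^ n)).filter fun d => encodeNat d ∈ iq3Lang) = ∅ := by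
          refine filter_eq_empty_iff.2 fun d hd hmem => ?_
          rw [mem_Ico] at hd
          have h16 : 2 ^ n ≤ 16 := by interval_cases n <;> norm_num
          exact not_mem_iq3Set_of_lt_sixteen (by omega) ((encodeNat_mem_iq3Lang d).1 hmem)
        rw [hempty, card_empty]
        exact Nat.zero_le _
    exact_mod_cast key
  · have h0 : ensUnif.prob n iq3Lang = 0 := by
      unfold Ensemble.prob ensUnif
      rw [dif_neg hne, PMF.toOuterMeasure_pure_apply, if_neg nil_not_mem_iq3Lang]
      simp
    rw [h0]; norm_num

end Conditioning

end Summit.QuantumAdvantage.QuantumAdvantage.Cruxes.AvgFaceBeyondPrior.Disproof
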